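import Summits.CriticalPhenomena.Ising3DConformalLimit.Theorems.HyperoctahedralRPExistsScaleCovariantLimitSplitGlue
import Summits.CriticalPhenomena.Ising3DConformalLimit.Theses.UnitLightCone
import HarnessLib

/-!
# Route `UnitLightCone`, crux #4 `(C)` = shared item stmt-CriticalPhenomena-1981: the SPLIT ASSEMBLY BY NAME

Crux-strategist `planner-cstrat-stmt-CriticalPhenomena-1981-r1-0` (instance UnitLightCone, 2026-08-17; RESTATED re-exam,
BC2 redirect). Route `route-CriticalPhenomena-UnitLightCone` declares its OWN copy
`Theses.UnitLightCone.ExistsScaleCovariantLimit` of the shared existence crux (same body as the `HyperoctahedralRP` copy on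
which every landed certificate of the crux chain is typed). The route-level split (gen 6, 2026-08-17T12:39Z) makes the two
EXISTING items

* stmt-CriticalPhenomena-6150 `MirrorHoelderCompactness.TwoPointDoubling` (compactness half) and
* stmt-CriticalPhenomena-4659 `ClusterRigidity.ClusterSetTotallyDisconnected` (identification half)

the route's leaves under the parent `ExistsScaleCovariantLimit`, glued by the landed curried theorem
`SplitGlue.hrp_crux_of_doubling_of_totallyDisconnected` (one line over p139907
`FoldedCurrentRepulsion.crux_iff_doubling_and_totallyDisconnected`). This file states the assembly and the exactness of the
split CONCLUDING / CONSUMING THE ROUTE'S COPY BY NAME, so that audits keyed on the `UnitLightCone` decl read them directly: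

* `ulc_crux_of_doubling_of_totallyDisconnected : TwoPointDoubling → ClusterSetTotallyDisconnected → UnitLightCone.ExistsScaleCovariantLimit`
  — THE ASSEMBLY (the HRP-typed landed term is accepted at the ULC copy by `δ`-unfolding);
* `ulc_crux_iff_doubling_and_totallyDisconnected` — the split is EXACT (an `↔`), so both pieces are load-bearing;
* `twoPointDoubling_of_ulc_crux`, `clusterSetTotallyDisconnected_of_ulc_crux` — each piece is a consequence of the crux;
* `ulc_crux_iff_hrp` — the two route copies are one proposition (`Iff.rfl`).

Nothing is weakened or strengthened; no definitions; composition of landed theorems only. Candidate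
`Theorems/UnitLightConeExistsScaleCovariantLimitSplitGlue.lean` — any prover may land it verbatim
`--supports stmt-CriticalPhenomena-1981` (Theorems/ is prover-only for this seat).

Why neither piece is the crux or the summit on its own (census `Cruxes/ExistsScaleCovariantLimit/STRATEGY-CENSUS-r1-instULC.md`):
the per-piece probes `Xᵢ → Ising3DConformalLimit`, `Xᵢ → ExistsScaleCovariantLimit` by `first | exact? | simpa | (unfold; simpa) | aesop`
FAIL in the minimal and in the maximal import context (4/4 and 6/6), `#h21_crux_probe` reports VERDICT: CLEAN for both pieces and for
the parent, and in substance `W_ε` (Disproof §E) ⊨ TwoPointDoubling ∧ ¬crux while ClusterSetTotallyDisconnected is silent along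
divergent scales of the pinned zoom.

References: H. Duminil-Copin, ICM 2022, §8.4 [DuminilCopinICM2022]; M. Aizenman, H. Duminil-Copin, Ann. of Math. 194 (2021),
arXiv:1912.07973, Remark 5.10 [AizenmanDuminilCopinAnnals2021].
-/

noncomputable section

namespace Summit.CriticalPhenomena.Ising3DConformalLimit.Cruxes.ExistsScaleCovariantLimit.UnitLightConeSplit

open Summit.CriticalPhenomena.Ising3DConformalLimit.Theses
open Summit.CriticalPhenomena.Ising3DConformalLimit.Cruxes.ExistsScaleCovariantLimit.FoldedCurrentRepulsion
  (crux_iff_doubling_and_totallyDisconnected)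

/-- The `UnitLightCone` copy of the shared crux is the `HyperoctahedralRP` copy (same body). [folklore] -/
theorem ulc_crux_iff_hrp :
    UnitLightCone.ExistsScaleCovariantLimit ↔ HyperoctahedralRP.ExistsScaleCovariantLimit :=
  Iff.rfl

/-- **THE ASSEMBLY, route `UnitLightCone`'s copy by name**: item 6150 `TwoPointDoubling` and item 4659
`ClusterSetTotallyDisconnected` give the crux `UnitLightCone.ExistsScaleCovariantLimit`. [folklore] -/
theorem ulc_crux_of_doubling_of_totallyDisconnected : Summit.CriticalPhenomena.Ising3DConformalLimit.Theses.MirrorHoelderCompactness.TwoPointDoubling → Summit.CriticalPhenomena.Ising3DConformalLimit.Theses.ClusterRigidity.ClusterSetTotallyDisconnected → Summit.CriticalPhenomena.Ising3DConformalLimit.Theses.UnitLightCone.ExistsScaleCovariantLimit :=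
  SplitGlue.hrp_crux_of_doubling_of_totallyDisconnected

/-- **EXACTNESS of the split at the `UnitLightCone` copy**: the crux ⟺ item 6150 ∧ item 4659 (p139907). [cite: AizenmanDuminilCopinAnnals2021, arXiv:1912.07973 Remark 5.10] -/
theorem ulc_crux_iff_doubling_and_totallyDisconnected :
    UnitLightCone.ExistsScaleCovariantLimit ↔
      MirrorHoelderCompactness.TwoPointDoubling ∧ ClusterRigidity.ClusterSetTotallyDisconnected :=
  ulc_crux_iff_hrp.trans crux_iff_doubling_and_totallyDisconnected

/-- The crux (ULC copy) forces the open all-scale axis doubling, item 6150. [cite: AizenmanDuminilCopinAnnals2021, arXiv:1912.07973 Remark 5.10] -/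
theorem twoPointDoubling_of_ulc_crux (h : UnitLightCone.ExistsScaleCovariantLimit) :
    MirrorHoelderCompactness.TwoPointDoubling :=
  (ulc_crux_iff_doubling_and_totallyDisconnected.1 h).1

/-- The crux (ULC copy) forces total disconnectedness of the cluster set, item 4659. [folklore] -/
theorem clusterSetTotallyDisconnected_of_ulc_crux (h : UnitLightCone.ExistsScaleCovariantLimit) :
    ClusterRigidity.ClusterSetTotallyDisconnected :=
  (ulc_crux_iff_doubling_and_totallyDisconnected.1 h).2

/-- Contrapositive: refuting item 6150 refutes the crux on this route. [folklore] -/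
theorem not_ulc_crux_of_not_twoPointDoubling (h : ¬ MirrorHoelderCompactness.TwoPointDoubling) :
    ¬ UnitLightCone.ExistsScaleCovariantLimit :=
  fun h' => h (twoPointDoubling_of_ulc_crux h')

/-- Contrapositive: refuting item 4659 refutes the crux on this route. [folklore] -/
theorem not_ulc_crux_of_not_totallyDisconnected (h : ¬ ClusterRigidity.ClusterSetTotallyDisconnected) :
    ¬ UnitLightCone.ExistsScaleCovariantLimit :=
  fun h' => h (clusterSetTotallyDisconnected_of_ulc_crux h')

end Summit.CriticalPhenomena.Ising3DConformalLimit.Cruxes.ExistsScaleCovariantLimit.UnitLightConeSplit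

end
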